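/-
Copyright (c) 2026. All rights reserved.
Released under Apache 2.0 license as described in the file LICENSE.
Authors: abc-iut cell, prover seat abc-iut-L6-t14 (wave 2, generation 2).
-/
import Literature.RingTheory.MvPowerSeries.AdicTaylor
import Literature.RingTheory.MvPowerSeries.NonzeroValues
import Literature.RingTheory.HenselLemma.PositiveSlopePowerSeries
import Mathlib.RingTheory.DiscreteValuationRing.Basic
import HarnessLib

/-!
# [AbsTopII] Lemma 2.1 (positive slope Hensel) for formal POWER SERIES, Lemmas 2.2 and 2.3 — proved

S. Mochizuki, *Topics in Absolute Anabelian Geometry II: Decomposition Groups and Endomorphisms*,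
J. Math. Sci. Univ. Tokyo 20 (2013) [MochizukiAbsTopII2013], §2 pp. 31–33 (manuscript
pagination, lit key `paper:url-585b8d0ad0d9`).

**Lemma 2.1** (p. 31): `k` a complete discretely valued field, `𝒪_k`, `𝔪_k`, `π` a uniformizer,
`A = 𝒪_k[[X₁,…,X_m]]`, `B = 𝒪_k[[Y₁,…,Y_n]]` (topologies given by the maximal ideals),
`𝒳 = Spf A`, `𝒴 = Spf B`, `φ : B → A` "the continuous `𝒪_k`-algebra homomorphism induced by an
assignment `Yⱼ ↦ fⱼ(X₁,…,X_m) ∈ A`", and "suppose that the induced morphism `dφ : Ω_B ⊗_B A → Ω_A`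
satisfies the property that the image of `dφ ⊗_A K_A` is a `K_A`-subspace of rank `n` in
`Ω_A ⊗_A K_A` [so `n ≤ m`]. Then there exists a point `β₀ ∈ 𝒴(𝒪_k)` and a positive integer `r`
satisfying the following property: Let `k'` be a finite extension of `k`, with ring of integers
`𝒪_{k'}`; write `B(β₀, k', r)` for the 'ball' of points `β' ∈ 𝒴(𝒪_{k'})` such that `β', β₀` map to
the same point of `𝒴(𝒪_{k'}/(π^r))`. Then the image of the map `𝒳(𝒪_{k'}) → 𝒴(𝒪_{k'})` induced
by `φ` contains the 'ball' `B(β₀, k', r)`."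

The tree so far holds the POLYNOMIAL special case (`fⱼ ∈ 𝒪_k[X]`): the first typing
`positiveSlopeHensel_polynomial` (`AbsTopII/PositiveSlopeHensel.lean`, refuted as typed — it
dropped the continuity of `φ`), its corrected successor `positiveSlopeHensel_polynomial'` and the
proofs `positiveSlopeHensel_polynomial_of_constantCoeff_mem` / `_uniform`
(`AbsTopII/PositiveSlopeHenselCorrected.lean`, `AbsTopII/PositiveSlopeHenselPolynomial.lean`),
each carrying "TODO(general form): power series `fⱼ ∈ 𝒪_k[[X]]`". This file PROVES the printed
general form (`positiveSlopeHensel_powerSeries_uniform`, `positiveSlopeHensel_powerSeries`):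
`fⱼ` formal power series, `𝒪_k` any complete discrete valuation ring `O`, the points of the formal
schemes taken in coordinates — `𝒳(O') = 𝔪_{O'}^m`, `𝒴(O') = 𝔪_{O'}^n`, a continuous
`O`-homomorphism `O[[X]] → O'` being determined by the images of the `Xᵢ`, which are topologically
nilpotent (Bourbaki, *Alg. Comm.* III §4 no. 5 Prop. 6) — the map `𝒳(O') → 𝒴(O')` being
`x ↦ (fⱼ(x))ⱼ` with `fⱼ(x)` the `𝔪_{O'}`-adic evaluation
(`Literature.RingTheory.MvPowerSeries.adicEval`), the continuity of `φ` being `fⱼ(0) ∈ 𝔪_k`, and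
the rank condition being the non-vanishing in `A` (an integral domain) of some `n × n` minor of the
Jacobian `(∂fⱼ/∂Xᵢ)` (partial derivatives = the tree's `Literature.RingTheory.MvPowerSeries.pd`).
The uniformity is proved for EVERY local `O`-algebra `O'` complete and separated for its maximal
ideal with local structure map (this contains `O' = 𝒪_{k'}`, `k'/k` finite), the ball being
`{β' | β'ⱼ - β₀ⱼ ∈ π^r O'}` ("map to the same point of `𝒴(𝒪_{k'}/(π^r))`").

**Lemma 2.3** (p. 33, "Nonzero Values of Functions Defined by Power Series"): "Let `k, 𝒪_k, A` be
as in Lemma 2.1; `f ∈ A` a nonzero element. Then there exist elements `xᵢ ∈ 𝔪_k`, where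
`i = 1, …, m`, such that `f(x₁, …, x_m) ∈ 𝔪_k` is nonzero." Proved as `exists_adicEval_ne_zero_dvr`
(conclusion `f(x) ≠ 0`; the display's "`∈ 𝔪_k`" holds when `f(0) ∈ 𝔪_k` and is not used in the
proof of Lemma 2.1, where `f = g` is the Jacobian determinant, possibly a unit — recorded, no
further claim) from the general `Literature.RingTheory.MvPowerSeries.exists_adicEval_ne_zero`.
**Lemma 2.2** (p. 32, "Subspaces and Bases of a Vector Space": a subspace `W` of a vector space
with basis `{eᵢ}_{i∈I}` has a complement `V_J` spanned by some of the `eⱼ`) is proved as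
`exists_isCompl_span_basis` (over any division ring, without finite-dimensionality); it enters the
printed proof of Lemma 2.1 only to reduce to a square system, a reduction which here is the choice
of the minor `S` (the remaining variables are frozen), exactly as in the polynomial file.

Proof of Lemma 2.1 (the printed Newton iteration, pp. 31–32, in the quantitative form of the
polynomial file): Lemma 2.3 gives `x₀ ∈ 𝔪^m` with `d := D(x₀) ≠ 0`, `D = det(∂fⱼ/∂X_{S k})`; write
`(d) = 𝔪^δ`, `β₀ := f(x₀)`, `r := 2δ + 1`. Over `O'`, re-expand `fⱼ` at `x₀` (Taylor series
`taylorAt`, `AdicTaylor.lean`: `fⱼ(x₀ + w) = Tⱼ(w)`, linear coefficients `(∂fⱼ/∂Xᵢ)(x₀)`), and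
solve `T(d·z along S) = T(0) + d²·η` by the positive-slope Hensel engine for power series
(`HenselLemma.exists_adicEval_eq_det_sq`), where `β' - β₀ = d²·η` because `π^{2δ+1} = (d u)² π`.
No side is taken on anything in the IUT corpus ([IUTchI] p. 67 cites only "the method of proof of
[AbsTopII], Lemma 2.1"); this is a classical lemma of a refereed paper, kernel-checked.
-/

noncomputable section

namespace Literature.AnabelianGeometry.AbsoluteAnabelian

open _root_.MvPowerSeries IsLocalRing Literature.RingTheory.MvPowerSeries
  Literature.RingTheory.HenselLemma

universe u

/-! ### [AbsTopII] Lemma 2.3 over a complete discrete valuation ring -/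

-- `IsDiscreteValuationRing O` takes `[IsDomain O]` as a parameter, so both binders are needed.
set_option linter.overlappingInstances false in
/-- **[AbsTopII] Lemma 2.3 (Nonzero Values of Functions Defined by Power Series)**: `O = 𝒪_k` a
complete discrete valuation ring with maximal ideal `𝔪`, `f ∈ O[[X₁, …, X_m]]` nonzero; then there
are `xᵢ ∈ 𝔪` with `f(x₁, …, x_m) ≠ 0` (value = `𝔪`-adic evaluation). (The display prints
"`f(x) ∈ 𝔪_k` is nonzero"; `f(x) ∈ 𝔪` holds iff `f(0) ∈ 𝔪`, cf. `adicEval_mem_of_constantCoeff_mem`,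
and only `f(x) ≠ 0` is used in the proof of Lemma 2.1.) [cite: MochizukiAbsTopII2013, Lemma 2.3 p.33] -/
theorem exists_adicEval_ne_zero_dvr (O : Type u) [CommRing O] [IsDomain O]
    [IsDiscreteValuationRing O] [IsAdicComplete (maximalIdeal O) O] {m : ℕ}
    {f : MvPowerSeries (Fin m) O} (hf : f ≠ 0) :
    ∃ x : Fin m → O, (∀ i, x i ∈ maximalIdeal O) ∧ adicEval (maximalIdeal O) x f ≠ 0 :=
  exists_adicEval_ne_zero (IsDiscreteValuationRing.not_a_field O) hf

/-! ### [AbsTopII] Lemma 2.1 for power series -/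

/-- Partial derivatives commute with coefficientwise ring homomorphisms.
[cite: MochizukiAbsTopII2013, Lemma 2.1 p.31] -/
theorem pd_map {A B : Type*} [CommRing A] [CommRing B] (φ : A →+* B) {τ : Type*} [DecidableEq τ]
    (i : τ) (g : MvPowerSeries τ A) :
    pd i (MvPowerSeries.map φ g) = MvPowerSeries.map φ (pd i g) := by
  rw [← hasseDeriv_single_eq_pd, ← map_hasseDeriv, hasseDeriv_single_eq_pd]

-- as above: both `[IsDomain O]` and `[IsDiscreteValuationRing O]` are needed.
set_option linter.overlappingInstances false in
/-- **[AbsTopII] Lemma 2.1 (Positive Slope Version of Hensel's Lemma), general form, uniform in the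
extension.** Let `O` (= `𝒪_k`) be a complete discrete valuation ring with maximal ideal `𝔪` and
uniformizer `π`, `f₁, …, f_n ∈ O[[X₁, …, X_m]]` formal power series with `fⱼ(0) ∈ 𝔪` (continuity of
`Yⱼ ↦ fⱼ`), and suppose some `n × n` minor `det(∂fⱼ/∂X_{S k})` of the Jacobian is a nonzero power
series (the differential has rank `n` over the fraction field of `A = O[[X]]`). Then there are
`β₀ ∈ 𝔪ⁿ = 𝒴(O)` and `r > 0` such that for EVERY local `O`-algebra `O'` complete and separated for
its maximal ideal `𝔪'` and with local structure map (e.g. `O' = 𝒪_{k'}`, `k'/k` finite), every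
`β' ∈ O'ⁿ` with `β'ⱼ - β₀ⱼ ∈ π^r O'` ("`β', β₀` map to the same point of `𝒴(𝒪_{k'}/(π^r))`") is
`(fⱼ(x))ⱼ` for some `x ∈ 𝔪'^m = 𝒳(O')` — "the image of `𝒳(𝒪_{k'}) → 𝒴(𝒪_{k'})` contains the ball
`B(β₀, k', r)`". Values are adic evaluations of the base-changed series.
[cite: MochizukiAbsTopII2013, Lemma 2.1 p.31] -/
theorem positiveSlopeHensel_powerSeries_uniform
    (O : Type u) [CommRing O] [IsDomain O] [IsDiscreteValuationRing O]
    [IsAdicComplete (maximalIdeal O) O] (m n : ℕ) (f : Fin n → MvPowerSeries (Fin m) O)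
    (hf0 : ∀ j, constantCoeff (f j) ∈ maximalIdeal O)
    (hS : ∃ S : Fin n ↪ Fin m, (Matrix.of fun j k : Fin n => pd (S k) (f j)).det ≠ 0) :
    ∃ (β₀ : Fin n → O) (r : ℕ), (∀ j, β₀ j ∈ maximalIdeal O) ∧ 0 < r ∧
      ∀ (O' : Type u) [CommRing O'] [IsLocalRing O'] [Algebra O O']
        [IsAdicComplete (maximalIdeal O') O'] [IsLocalHom (algebraMap O O')] (β' : Fin n → O'),
        (∀ j, β' j - algebraMap O O' (β₀ j) ∈ (maximalIdeal O ^ r).map (algebraMap O O')) →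
          ∃ x : Fin m → O', (∀ i, x i ∈ maximalIdeal O') ∧
            ∀ j, adicEval (maximalIdeal O') x (MvPowerSeries.map (algebraMap O O') (f j)) = β' j := by
  obtain ⟨S, hD⟩ := hS
  set 𝔪 : Ideal O := maximalIdeal O
  -- Step 1 (Lemma 2.3): a point `x₀ ∈ 𝔪^m` where the Jacobian minor does not vanish
  set D : MvPowerSeries (Fin m) O := (Matrix.of fun j k : Fin n => pd (S k) (f j)).det with hDdef
  obtain ⟨x₀, hx₀𝔪, hx₀D⟩ := exists_adicEval_ne_zero_dvr O hD
  -- the numerical minor at `x₀` and its determinant `d ≠ 0`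
  set Jx : Matrix (Fin n) (Fin n) O := Matrix.of fun j k => adicEval 𝔪 x₀ (pd (S k) (f j))
    with hJx
  set d : O := Jx.det with hd
  have hdD : d = adicEval 𝔪 x₀ D := by
    rw [hd, hDdef, ← adicEvalHom_apply hx₀𝔪, RingHom.map_det, RingHom.mapMatrix_apply]
    congr 1
    ext j k
    simp only [Matrix.map_apply, Matrix.of_apply, adicEvalHom_apply hx₀𝔪, hJx]
    rfl
  have hd0 : d ≠ 0 := hdD ▸ hx₀D
  -- Step 2: `(d) = 𝔪^δ`; the centre `β₀ := f(x₀)` and the exponent `r := 2δ + 1`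
  obtain ⟨ϖ, hϖ⟩ := IsDiscreteValuationRing.exists_irreducible O
  obtain ⟨δ, u, hu⟩ := IsDiscreteValuationRing.associated_pow_irreducible hd0 hϖ
  have hϖ𝔪 : ϖ ∈ maximalIdeal O := by
    rw [hϖ.maximalIdeal_eq]; exact Ideal.mem_span_singleton_self ϖ
  refine ⟨fun j => adicEval 𝔪 x₀ (f j), 2 * δ + 1, fun j => ?_, by omega, ?_⟩
  · exact adicEval_mem_of_constantCoeff_mem hx₀𝔪 (hf0 j)
  intro O' _ _ _ _ _ β' hβ'
  set φ : O →+* O' := algebraMap O O' with hφ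
  set 𝔪' : Ideal O' := maximalIdeal O'
  have hφ𝔪 : 𝔪.map φ ≤ 𝔪' := Ideal.map_le_iff_le_comap.mpr fun a ha => map_nonunit φ a ha
  have hϖ' : φ ϖ ∈ 𝔪' := map_nonunit φ ϖ hϖ𝔪
  -- Step 3: base change to `O'` and Taylor re-expansion at `x₀`
  set f' : Fin n → MvPowerSeries (Fin m) O' := fun j => MvPowerSeries.map φ (f j) with hf'
  set x₀' : Fin m → O' := fun i => φ (x₀ i) with hx₀'
  have hx₀'𝔪 : ∀ i, x₀' i ∈ 𝔪' := fun i => map_nonunit φ _ (hx₀𝔪 i)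
  set T : Fin n → MvPowerSeries (Fin m) O' := fun j => taylorAt 𝔪' x₀' (f' j) with hT
  have hTlin : (Matrix.of fun j k : Fin n => coeff (Finsupp.single (S k) 1) (T j)) =
      φ.mapMatrix Jx := by
    ext j k
    simp only [Matrix.of_apply, hT, coeff_single_taylorAt, hf', pd_map, RingHom.mapMatrix_apply,
      Matrix.map_apply, hJx]
    rw [← map_adicEval φ hφ𝔪 hx₀𝔪]
  have hTdet : (Matrix.of fun j k : Fin n => coeff (Finsupp.single (S k) 1) (T j)).det = φ d := by
    rw [hTlin, hd, RingHom.map_det]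
  have hT0 : ∀ j, constantCoeff (T j) = φ (adicEval 𝔪 x₀ (f j)) := fun j => by
    rw [hT, constantCoeff_taylorAt, hf', ← map_adicEval φ hφ𝔪 hx₀𝔪]
  -- `β' - β₀ = (φ d)² · η` with `η ∈ 𝔪'`
  have hη : ∀ j, ∃ η : O', η ∈ 𝔪' ∧ β' j - φ (adicEval 𝔪 x₀ (f j)) = φ d ^ 2 * η := by
    intro j
    have h := hβ' j
    have h𝔪pow : ((𝔪 ^ (2 * δ + 1)).map φ : Ideal O') = Ideal.span {φ ϖ ^ (2 * δ + 1)} := by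
      show (maximalIdeal O ^ _).map φ = _
      rw [hϖ.maximalIdeal_eq, Ideal.span_singleton_pow, Ideal.map_span, Set.image_singleton,
        map_pow]
    rw [h𝔪pow, Ideal.mem_span_singleton'] at h
    obtain ⟨c, hc⟩ := h
    refine ⟨c * φ ϖ * φ (u : O) ^ 2, 𝔪'.mul_mem_right _ (𝔪'.mul_mem_left _ hϖ'), ?_⟩
    rw [← hc]
    have : φ ϖ ^ (2 * δ + 1) = (φ d * φ (u : O)) ^ 2 * φ ϖ := by
      rw [← map_mul, hu, map_pow]; ring
    rw [this]; ring
  choose η hη𝔪 hηeq using hη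
  -- Step 4: the positive-slope Hensel engine for the Taylor series along the directions `S`
  obtain ⟨z, hz𝔪, hz⟩ := exists_adicEval_eq_det_sq (I := 𝔪') T S η hη𝔪
  -- name the point `w` produced by the engine (`w_{S k} = (det) z_k`, `w_i = 0` otherwise)
  -- (the `Decidable (∃ k, S k = i)` instance inside the engine's point is the generic `Fintype`
  -- one, so we access the point only through `dif_pos` / `dif_neg`)
  obtain ⟨w, hzw, hwS, hw0⟩ : ∃ w : Fin m → O',
      (∀ j, adicEval 𝔪' w (T j) = constantCoeff (T j) +
        (Matrix.of fun j k : Fin n => coeff (Finsupp.single (S k) 1) (T j)).det ^ 2 * η j) ∧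
      (∀ k, w (S k) =
        (Matrix.of fun j k : Fin n => coeff (Finsupp.single (S k) 1) (T j)).det * z k) ∧
      ∀ i, (¬ ∃ k, S k = i) → w i = 0 := by
    refine ⟨_, hz, fun k => ?_, fun i hi => ?_⟩
    · rw [dif_pos (⟨k, rfl⟩ : ∃ k', S k' = S k)]
      congr 1
      exact congrArg z (S.injective (⟨k, rfl⟩ : ∃ k', S k' = S k).choose_spec)
    · rw [dif_neg hi]
  have hw𝔪 : ∀ i, w i ∈ 𝔪' := by
    intro i
    by_cases hi : ∃ k, S k = i
    · obtain ⟨k, rfl⟩ := hi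
      rw [hwS k]
      exact 𝔪'.mul_mem_left _ (hz𝔪 k)
    · rw [hw0 i hi]
      exact 𝔪'.zero_mem
  refine ⟨x₀' + w, fun i => 𝔪'.add_mem (hx₀'𝔪 i) (hw𝔪 i), fun j => ?_⟩
  rw [adicEval_add_eq_adicEval_taylorAt hx₀'𝔪 hw𝔪 (f' j)]
  have hzj := hzw j
  rw [hTdet, hT0] at hzj
  rw [show taylorAt 𝔪' x₀' (f' j) = T j from rfl, hzj, ← hηeq j]
  ring

-- as above: both `[IsDomain O]` and `[IsDiscreteValuationRing O]` are needed.
set_option linter.overlappingInstances false in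
/-- **[AbsTopII] Lemma 2.1 (Positive Slope Version of Hensel's Lemma), general power-series form,
`k' = k`**: `O` a complete discrete valuation ring, `f₁, …, f_n ∈ O[[X₁, …, X_m]]` with `fⱼ(0) ∈ 𝔪`
and some `n × n` Jacobian minor a nonzero power series; then there are `β₀ ∈ 𝔪ⁿ` and `r > 0` such
that every `β' ∈ Oⁿ` with `β' ≡ β₀ (mod 𝔪^r)` coordinatewise is `(fⱼ(x))ⱼ` (adic evaluation) for
some `x ∈ 𝔪^m`: "the image of `𝒳(𝒪_k) → 𝒴(𝒪_k)` contains the ball `B(β₀, k, r)`".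
[cite: MochizukiAbsTopII2013, Lemma 2.1 p.31] -/
theorem positiveSlopeHensel_powerSeries
    (O : Type u) [CommRing O] [IsDomain O] [IsDiscreteValuationRing O]
    [IsAdicComplete (maximalIdeal O) O] (m n : ℕ) (f : Fin n → MvPowerSeries (Fin m) O)
    (hf0 : ∀ j, constantCoeff (f j) ∈ maximalIdeal O)
    (hS : ∃ S : Fin n ↪ Fin m, (Matrix.of fun j k : Fin n => pd (S k) (f j)).det ≠ 0) :
    ∃ (β₀ : Fin n → O) (r : ℕ), (∀ j, β₀ j ∈ maximalIdeal O) ∧ 0 < r ∧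
      ∀ β' : Fin n → O, (∀ j, β' j - β₀ j ∈ maximalIdeal O ^ r) →
        ∃ x : Fin m → O, (∀ i, x i ∈ maximalIdeal O) ∧
          ∀ j, adicEval (maximalIdeal O) x (f j) = β' j := by
  obtain ⟨β₀, r, hβ₀, hr, h⟩ := positiveSlopeHensel_powerSeries_uniform O m n f hf0 hS
  refine ⟨β₀, r, hβ₀, hr, fun β' hβ' => ?_⟩
  haveI : IsLocalHom (algebraMap O O) := isLocalHom_id O
  obtain ⟨x, hx, hfx⟩ := h O β' (fun j => by
    rw [Algebra.algebraMap_self, Ideal.map_id]; exact hβ' j)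
  refine ⟨x, hx, fun j => ?_⟩
  have := hfx j
  rwa [Algebra.algebraMap_self, MvPowerSeries.map_id, RingHom.id_apply] at this

/-! ### [AbsTopII] Lemma 2.2 (Subspaces and Bases of a Vector Space) -/

/-- **[AbsTopII] Lemma 2.2 (Subspaces and Bases of a Vector Space)**: "Let `k` be a field; `V` a
finite-dimensional `k`-vector space with basis `{eᵢ}_{i ∈ I}`; `W ⊆ V` a `k`-subspace. Then there
exists a subset `J ⊆ I` such that if we write `V_J ⊆ V` for the `k`-subspace generated by the
`eⱼ`, for `j ∈ J`, then the natural inclusions `V_J ↪ V`, `W ↪ V` determine an isomorphism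
`V_J ⊕ W ⥲ V` of `k`-vector spaces" — i.e. `V_J` and `W` are complementary submodules (`IsCompl`;
the isomorphism is then Mathlib's `Submodule.prodEquivOfIsCompl`). Proved ("elementary linear
algebra", p. 33) for any vector space over a division ring, finite-dimensionality being
unnecessary: take `J` maximal with `(eⱼ mod W)_{j ∈ J}` linearly independent in `V/W`.
[cite: MochizukiAbsTopII2013, Lemma 2.2 p.32] -/
theorem exists_isCompl_span_basis {k V ι : Type*} [DivisionRing k] [AddCommGroup V] [Module k V]
    (e : Module.Basis ι k V) (W : Submodule k V) :
    ∃ J : Set ι, IsCompl (Submodule.span k (e '' J)) W := by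
  classical
  -- a maximal linearly independent subfamily of `(eᵢ mod W)` ; it spans `V/W`
  obtain ⟨J, -, -, hspan, hli⟩ := exists_linearIndepOn_extension (K := k) (v := W.mkQ ∘ e)
    (linearIndepOn_empty k _) (Set.empty_subset Set.univ)
  refine ⟨J, ⟨?_, ?_⟩⟩
  · -- disjointness: an element of `V_J ∩ W` has a relation among the `eⱼ mod W`
    rw [Submodule.disjoint_def]
    intro x hxJ hxW
    obtain ⟨l, hl, rfl⟩ := (Finsupp.mem_span_image_iff_linearCombination k).mp hxJ
    have h0 : Finsupp.linearCombination k (W.mkQ ∘ e) l = 0 := by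
      rw [← Finsupp.apply_linearCombination, Submodule.mkQ_apply, Submodule.Quotient.mk_eq_zero]
      exact hxW
    rw [(linearIndepOn_iff.mp hli) l hl h0, map_zero]
  · -- codisjointness: `(eⱼ mod W)_{j ∈ J}` spans `V/W`
    rw [codisjoint_iff, sup_comm, ← Submodule.map_mkQ_eq_top, Submodule.map_span, eq_top_iff,
      ← Set.image_comp]
    have htop : (⊤ : Submodule k (V ⧸ W)) ≤ Submodule.span k (Set.range (W.mkQ ∘ e)) := by
      rw [Set.range_comp, ← Submodule.map_span, e.span_eq, Submodule.map_top, Submodule.range_mkQ]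
    refine htop.trans (Submodule.span_le.mpr ?_)
    rw [← Set.image_univ]
    exact hspan

end Literature.AnabelianGeometry.AbsoluteAnabelian
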